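import Summits.RiemannHypothesis.RiemannHypothesis.Theorems.TiltedLandingLaw421R3PerturbativeRung

/-!
# RUNG-P v6 SOCKET — the PAIR-LIGHT split (lens-2 g7; director (CA677) GO TO TYPE on `lens2/K2-SOCKET-MEMO-v1.md` e536d809; (CA673)(A): tree #1179 is
# NEVER edited — the repaired socket is this NEW module, importing #1179 only; HELD for hands ×3, law-level)

C1 g35's typing findings N1–N3 (MAP 92ca3b6240ed6146) against `RhW08.PerturbativeRung.PerturbativeDropLightQ C μ₀` (#1179 l.197): (N1) the v5 door
constant makes `C(1+μ₀) ≤ 15` infeasible — repaired in the PROOF by the a-posteriori bootstrap (R1), no binder (C1 IMAGE E `RhW08.LocatedPair.bootstrap_of_lightWitness`,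
GO-33-38: location error `≤ (6/5)(1+ρ₀)M_w/(λ_w²‖K_w‖)` ⇒ energy-linear error `2.43·M_w/λ_w` per child at `λ ≥ 30`); (N2) FIELD COHERENCE across the pair
(`‖K_z‖ ≈ κ_v`) is load-bearing for the `κ_v²`-currency and is NOT supplied by `LightAt v ∧ LightAt z`; (N3) the z-error is in `λ_z`-currency.
ANSWER (K2-SOCKET-MEMO-v1): ONE notion ★ `LightPairAt μ₀ f j v z` = both v5 point witnesses `LightWitness` with the SAME `M ≤ μ₀` ∧ the natural-unit
SEPARATION `Im v ≤ 2‖v − z‖` (near-coincident pairs are heavy: they merge) ∧ the HULL clause: the PAIR cofactor `g` (`f⁽ʲ⁾ = (·−v)(·−v̄)(·−z)(·−z̄)·g`) is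
zero-free on the segment `[v, z]` with `Im(u)²·‖(g′/g)′(u)‖ ≤ M` there (height-dependent unit ⇒ `|R(z) − R(v)| ≤ M‖z − v‖/(Im v·Im z)`, free of `Im z/Im v`)
— from which coherence `‖K_z − K_v‖ ≤ (5.2 + 2.9M)‖K_v‖/λ_v` is DERIVED in K-2's proof (closing N2 and N3).  Sockets: ★ `PerturbativeDropLightPairQ C μ₀`
(binders: frame, `BetaLevel`, floor at `v`, `LightPairAt μ₀`, floor at `z`; conclusion `3 − C(1+μ₀)/λ_v ≤ X` as in v5), ★ `NearMassMonotonePairQ μ₀`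
(HEAVY in the pair sense ⇒ `X ≥ 5/2` outright; UNPROVED, substantive; at `μ₀ = 1/2` STRONGER than v5's `NearMassMonotoneQ 2`, `nearMassMonotoneQ_of_pair`),
★ `rungP_of_lightPair_heavy` (PROVED, the v5 `by_cases` verbatim): `C(1+μ₀) ≤ 15` + the two ⟹ `RungP`; `lightAt_of_lightPairAt` (K-1's doors
`doorData_of_lightWitness` apply unchanged at both points).  Instance of record `(C, μ₀) = (10, 1/2)` (`rungP_of_pair_instance`).  FALSIFIER of record
(crit-1 column F-b): min X over legal charged β-rows with `λ_v ≥ 30` that are v6-HEAVY (`¬(LightPairAt (1/2) ∧ 30 ≤ λ_z)`), both tilt signs — a row with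
X < 5/2 kills `NearMassMonotonePairQ (1/2)` (substantive) and with it this split.  No implication-Props; 0 sorry.
Nothing here bears on the truth of RH; RH is not proved; RUNG-P = tree #1179 with OPEN hypotheses; these sockets are STATEMENTS; C′ / ★A / 33346 / 33347 OPEN.
-/

namespace RhW08.PerturbativeRung2

open Complex RhW08.Round1 RhW08.StSwap RhW08.Round2 RhW08.QuadW RhW08.SealSwapQ RhW08.RateSplit RhW08.BurgersRate RhW08.BurgersRateG3
open RhW08.SealSwap (PBot)
open RhW08.TouchedDissipation RhW08.PerturbativeRung
open RhW08.AntiEscapeSplit7 RhIdea6.G17.W07C7 RhIdea6.G17.W07C7.Rev6 RhIdea6.G18.W07C8.Law421BirthS RhIdea6.G19.W07C11.Seam RhIdea6.G20.W07C12.Frac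
open RhIdea6.G20.W07C12.StColP RhW07.C12.FieldSplit RhIdea6.G21.W07C13.TentMax RhW07.C14.TwoSided RhW07.C14.Classes RhW07.C14.Lineage RhW07.C14.Booking

/-- ★ (v6) LIGHT AS A PAIR within `μ₀` at level `j`: ONE mass `M ≤ μ₀` that is (i) a v5 light witness at `v` and at `z` (cofactors `dslope f⁽ʲ⁾ w`),
(ii) the natural-unit SEPARATION `Im v ≤ 2·‖v − z‖`, and (iii) the HULL clause — a pair cofactor `g` with `f⁽ʲ⁾ = (·−v)(·−v̄)(·−z)(·−z̄)·g`, zero-free on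
the closed segment `[v, z]` with the height-dependent natural-unit field-derivative bound `Im(u)²·‖(g′/g)′(u)‖ ≤ M` there. -/
def LightPairAt (μ₀ : ℝ) (f : ℂ → ℂ) (j : ℕ) (v z : ℂ) : Prop :=
  ∃ M : ℝ, M ≤ μ₀ ∧ LightWitness (dslope (iteratedDeriv j f) v) v M ∧ LightWitness (dslope (iteratedDeriv j f) z) z M ∧
    v.im ≤ 2 * ‖v - z‖ ∧
    ∃ g : ℂ → ℂ, Differentiable ℂ g ∧
      (∀ u : ℂ, iteratedDeriv j f u = (u - v) * (u - (starRingEnd ℂ) v) * (u - z) * (u - (starRingEnd ℂ) z) * g u) ∧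
      ∀ t : ℝ, 0 ≤ t → t ≤ 1 →
        g (v + (t : ℂ) * (z - v)) ≠ 0 ∧ (v + (t : ℂ) * (z - v)).im ^ 2 * ‖deriv (fun w => deriv g w / g w) (v + (t : ℂ) * (z - v))‖ ≤ M

/-- a light pair is light at both points in the v5 sense (so `doorData_of_lightWitness` / K-1 apply unchanged at `v` and at `z`). -/
theorem lightAt_of_lightPairAt {μ₀ : ℝ} {f : ℂ → ℂ} {j : ℕ} {v z : ℂ} (h : LightPairAt μ₀ f j v z) :
    LightAt μ₀ f j v ∧ LightAt μ₀ f j z := by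
  obtain ⟨M, hM, hv, hz, -, -⟩ := h
  exact ⟨⟨M, hM, hv⟩, ⟨M, hM, hz⟩⟩

/-- ★ (v6, K-2's TARGET LAW) the perturbative drop on PAIR-LIGHT β-levels: `X ≥ 3 − C·(1 + μ₀)/λ_v` whenever the pair `(v, z)` is light within `μ₀`
and both floors hold (PROOF ROUTE = C1 g35's compose D1–D4 with the (R1) bootstrap; coherence derived from the hull clause). -/
def PerturbativeDropLightPairQ (C μ₀ : ℝ) : Prop :=
  ∀ (η : ℝ) (f : ℂ → ℂ) (x₀ s hmax R Hs : ℝ) (B : ℕ), EngineHyps5 2 η f x₀ s hmax R Hs B → ∀ (j : ℕ) (v z : ℂ), BetaLevel η f x₀ s hmax R Hs B j v z →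
    30 ≤ v.im * stateKappa f j v → LightPairAt μ₀ f j v z → 30 ≤ z.im * stateKappa f j z →
      3 - C * (1 + μ₀) / (v.im * stateKappa f j v) ≤ ((v.im ^ 2 + z.im ^ 2) - childEnergy f j (pairUnion v z)) * stateKappa f j v ^ 2

/-- ★ (v6, UNPROVED, substantive) NEAR MASS RAISES X, pair sense: a β-level above the floor at `v` that is NOT (pair-light within `μ₀` with the floor at `z`)
has `X ≥ 5/2` outright.  Newly heavy versus v5: near-coincident pairs (`‖v − z‖ < Im v/2`: the two zeros merge into one staying child, `X ≈ λ_v²`),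
foreign zeros at pair scale from the segment (the atomic-edge zoo, crit-1 CUT 27: min X = 3.13), witnesses in `(μ₀, 2]`.  FALSIFIER: column F-b. -/
def NearMassMonotonePairQ (μ₀ : ℝ) : Prop :=
  ∀ (η : ℝ) (f : ℂ → ℂ) (x₀ s hmax R Hs : ℝ) (B : ℕ), EngineHyps5 2 η f x₀ s hmax R Hs B → ∀ (j : ℕ) (v z : ℂ), BetaLevel η f x₀ s hmax R Hs B j v z →
    30 ≤ v.im * stateKappa f j v → ¬ (LightPairAt μ₀ f j v z ∧ 30 ≤ z.im * stateKappa f j z) →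
      5 / 2 ≤ ((v.im ^ 2 + z.im ^ 2) - childEnergy f j (pairUnion v z)) * stateKappa f j v ^ 2

/-- the pair-sense heavy law implies v5's point-sense one at the same `μ₀` (its antecedent is larger). -/
theorem nearMassMonotoneQ_of_pair {μ₀ : ℝ} (hH : NearMassMonotonePairQ μ₀) : NearMassMonotoneQ μ₀ := by
  intro η f x₀ s hmax R Hs B hE j v z hβ hfl hnot
  refine hH η f x₀ s hmax R Hs B hE j v z hβ hfl ?_
  rintro ⟨hP, hz⟩
  exact hnot ⟨(lightAt_of_lightPairAt hP).1, (lightAt_of_lightPairAt hP).2, hz⟩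

/-- ★ (v6, PROVED) RUNG-P FROM THE PAIR SPLIT: `C·(1+μ₀) ≤ 15`, the pair-light drop and the pair-heavy monotonicity give RUNG-P. -/
theorem rungP_of_lightPair_heavy {C μ₀ : ℝ} (hCμ : C * (1 + μ₀) ≤ 15)
    (hL : PerturbativeDropLightPairQ C μ₀) (hH : NearMassMonotonePairQ μ₀) : RungP := by
  intro η f x₀ s hmax R Hs B hE j v z hch hA hlow ht ha hfl
  by_cases hlt : LightPairAt μ₀ f j v z ∧ 30 ≤ z.im * stateKappa f j z
  · have h := hL η f x₀ s hmax R Hs B hE j v z ⟨hch, hA, hlow, ht, ha⟩ hfl hlt.1 hlt.2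
    have hl : (0 : ℝ) < v.im * stateKappa f j v := by linarith
    have hq : C * (1 + μ₀) / (v.im * stateKappa f j v) ≤ 1 / 2 := by
      rw [div_le_iff₀ hl]; nlinarith
    linarith
  · exact hH η f x₀ s hmax R Hs B hE j v z ⟨hch, hA, hlow, ht, ha⟩ hfl hlt

/-- the instance of record `(C, μ₀) = (10, 1/2)`: `10·(3/2) = 15`. -/
theorem rungP_of_pair_instance (hL : PerturbativeDropLightPairQ 10 (1 / 2)) (hH : NearMassMonotonePairQ (1 / 2)) : RungP :=
  rungP_of_lightPair_heavy (by norm_num) hL hH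

end RhW08.PerturbativeRung2
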